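import Summits.AnomalousDissipation.AnomalousDissipation.Theorems.SolenoidalFractalHomogenisationLagrangianStepVmodFsHighAnyPhase
import Summits.AnomalousDissipation.AnomalousDissipation.Theorems.SolenoidalFractalHomogenisationLagrangianStepVmodSSRegimesA
import HarnessLib

/-!
# K1L_D (stmt-AnomalousDissipation-27980): (V_mod) flat stage, block (fs) — THE HIGH-CLASS ROW FOR A FAST CLASS DATUM in the allowance
# currency of `BlockBound` (any carrier phase, windows `τ ≥ P = M·W.period/ν`, `ν < νh`; row «H / high / τ ≥ P» of the certifier's table)
(helper; `--supports 27980 --as helper`; prover ad-k1loc-p3 g10; converts the per-label T-H leak `VmodFlat.norm_fc_le_of_highClass_anyPhase`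
(p718434) into the `hrow` shape of the row assembler `VmodFlat.fs_pairing_le_of_rows` (`…VmodFsRowsAssembly`).)

* `exp_neg_le_rpow_div` — `e^{−a·s} ≤ (1/s)^e / a` for `a > 0`, `s ≥ 1`, `e ≤ 1` (`s^e ≤ s ≤ e^{as}/a`);
* **`leak_le_alw_of_high_fast`** — for a slow label `ℓ` on a HIGH class (`L ≤ ‖ℓ‖`, `2‖ℓ‖ < n`) whose coarse rate over one period is
  bounded below, `θL ≤ 8π²·loT·L²·P` (`θL > 0`), a window `[s,t]` at ANY phase with `t − s ≥ P`, `ν < νh`, `n·ν ≤ Kb·L`, one W7 instance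
  (`1 ≤ CK`, `0 < cK`), and ANY `v ∈ V2` supported on the class pair of `ℓ`:
  `‖𝓕(U s t v)(ℓ)‖ ≤ (C₁(C₁(ν^e + (⌈K/ν⌉₊/n)^e) + (min 1 (P/(t−s)))^e)) · √(dW lo Λ c ν n (t−s) ℓ) · ‖v‖`
  for `e ≤ 1` and `C₁ ≥ √CK·e^{cK·M·W.period} / (cK·M·W.period·√(½·min 1 θL))` (T-H leak `√CK e^{cK M Wp} e^{−cKντ}`, `e^{−cKντ} ≤
  (P/τ)^e/(cK M Wp)`, `dW ≥ ½ min 1 (Rτ) ≥ ½ min 1 θL`).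
`sorry`-free; NOT a proof of (fs), of the stub, of K1L_D or of AD; rung F-D1.A0.
-/

set_option linter.dupNamespace false

noncomputable section

namespace Summit.AnomalousDissipation.AnomalousDissipation.Theorems.SolenoidalFractalHomogenisation.LagrangianStep.VmodFlat

open Literature.Analysis Literature.Analysis.FluidPDE Literature.Analysis.FunctionSpaces
open MeasureTheory Set Filter UnitAddTorus
open scoped ENNReal NNReal InnerProductSpace
open Summit.AnomalousDissipation.AnomalousDissipation.Theorems.SolenoidalFractalHomogenisation.LagrangianStep.CellClauseMod

/-! ## §1 Scalar tools -/

/-- `e^{−a s} ≤ (1/s)^e / a` for `a > 0`, `s ≥ 1`, `e ≤ 1`. [folklore] -/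
theorem exp_neg_le_rpow_div {a s e : ℝ} (ha : 0 < a) (hs : 1 ≤ s) (he1 : e ≤ 1) :
    Real.exp (-(a * s)) ≤ (1 / s) ^ e / a := by
  have hs0 : 0 < s := lt_of_lt_of_le one_pos hs
  -- `a s ≤ e^{a s}`
  have h1 : a * s ≤ Real.exp (a * s) := by linarith [Real.add_one_le_exp (a * s)]
  -- `s^e ≤ s`
  have h2 : s ^ e ≤ s := by
    calc s ^ e ≤ s ^ (1:ℝ) := Real.rpow_le_rpow_of_exponent_le hs he1
      _ = s := Real.rpow_one s
  have hse0 : 0 < s ^ e := Real.rpow_pos_of_pos hs0 e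
  -- `e^{-as} = 1/e^{as} ≤ 1/(a s) ≤ 1/(a s^e) = (1/s)^e/a`... via `s^e · e^{-as} ≤ s e^{-as} ≤ 1/a`
  have h3 : s * Real.exp (-(a * s)) ≤ 1 / a := by
    rw [Real.exp_neg, le_div_iff₀ ha]
    have hE := Real.exp_pos (a * s)
    calc s * (Real.exp (a * s))⁻¹ * a = (a * s) / Real.exp (a * s) := by field_simp
      _ ≤ 1 := (div_le_one hE).2 h1
  have h4 : s ^ e * Real.exp (-(a * s)) ≤ 1 / a :=
    (mul_le_mul_of_nonneg_right h2 (Real.exp_pos _).le).trans h3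
  have h5 : (1 / s) ^ e = 1 / s ^ e := by rw [Real.div_rpow zero_le_one hs0.le, Real.one_rpow]
  rw [h5, div_div, le_div_iff₀ (mul_pos hse0 ha)]
  calc Real.exp (-(a * s)) * (s ^ e * a) = (s ^ e * Real.exp (-(a * s))) * a := by ring
    _ ≤ (1 / a) * a := mul_le_mul_of_nonneg_right h4 ha.le
    _ = 1 := by field_simp

/-! ## §2 The high-class row -/

set_option maxHeartbeats 1600000 in
/-- **THE HIGH-CLASS ROW FOR A FAST CLASS DATUM, allowance currency, any phase.**  See the module docstring. -/
theorem leak_le_alw_of_high_fast {k : ℕ} (W : LatticeShear.LatticeWord k) (M : ℝ) (hM : 0 < M) {c : ℝ} (hc : 0 ≤ c)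
    {lo hi Λ β νh Kb CK cK K : ℝ}
    (hH : HighLabelDecayW W M hM lo hi Λ β νh Kb CK cK) (hlo : 0 < lo) (hhi : 0 ≤ hi) (hΛ : 1 ≤ Λ) (hCK : 1 ≤ CK) (hcK : 0 < cK)
    {ν : ℝ} (hν : ν ∈ Set.Ioo 0 νh) {n : ℕ} (hn : 1 ≤ n) {𝔸 : Torus.Visc4 (Fin 3)} (hodd : Torus.OddSmall 𝔸 (ν * β))
    (hwin : ∃ lam ∈ Set.Icc (1:ℝ) Λ, Torus.NearIso 𝔸 (ν * (lo / lam)) (ν * (hi * lam)))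
    {Tw : ℝ} {U : ℝ → ℝ → (V2 →L[ℝ] V2)} (hU : Torus.IsPropagator Tw (cellField W M hM ν hν.1 n) ((1 / (n:ℝ) ^ 2) • 𝔸) U)
    {s t : ℝ} (hs : 0 ≤ s) (htT : t ≤ Tw) (hτP : M * W.period / ν ≤ t - s)
    {L : ℝ} (hL : 0 < L) (hKL : (n : ℝ) * ν ≤ Kb * L)
    {θL : ℝ} (hθL0 : 0 < θL) (hθL : θL ≤ 8 * Real.pi ^ 2 * loT lo Λ c ν n * L ^ 2 * (M * W.period / ν))
    {ℓ : Fin 3 → ℤ} (hℓL : L ≤ ‖Torus.latticeVec ℓ‖) (hℓn : 2 * ‖Torus.latticeVec ℓ‖ < n)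
    (v : V2) (hvs : ∀ k', ¬ ((∀ i, (n:ℤ) ∣ k' i - ℓ i) ∨ (∀ i, (n:ℤ) ∣ k' i + ℓ i)) → fc v k' = 0)
    {C₁ e : ℝ} (he1 : e ≤ 1)
    (hC₁ : Real.sqrt CK * Real.exp (cK * (M * W.period)) / (cK * (M * W.period) * Real.sqrt ((1 / 2) * min 1 θL)) ≤ C₁) :
    ‖fc (U s t v) ℓ‖
      ≤ (C₁ * (C₁ * (ν ^ e + ((⌈K / ν⌉₊ : ℝ) / n) ^ e) + (min 1 ((M * W.period / ν) / (t - s))) ^ e))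
        * Real.sqrt (dW lo Λ c ν n (t - s) ℓ) * ‖v‖ := by
  have hν0 : 0 < ν := hν.1
  have hn0 : (0:ℝ) < n := by exact_mod_cast (show 0 < n from hn)
  have hΛ0 : 0 < Λ := lt_of_lt_of_le one_pos hΛ
  have hWp : 0 < W.period := PermissibleCarrier.period_pos W
  have hMW : 0 < M * W.period := mul_pos hM hWp
  set P : ℝ := M * W.period / ν with hPdef
  have hP0 : 0 < P := div_pos hMW hν0
  have hτ0 : 0 < t - s := lt_of_lt_of_le hP0 hτP
  have hloT : 0 ≤ loT lo Λ c ν n := by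
    unfold loT; have : 0 ≤ ν + c / ν := by positivity
    positivity
  -- the T-H leak at any phase
  have hTH := norm_fc_le_of_highClass_anyPhase W M hM hH hlo hhi hΛ hCK hcK.le hν hn hodd hwin hU hs htT hτP hL hKL hℓL hℓn v hvs
  -- `e^{−cKντ} ≤ (P/τ)^e/(cK M Wp)`
  set sP : ℝ := (t - s) / P with hsP
  have hsP1 : 1 ≤ sP := by rw [hsP, le_div_iff₀ hP0, one_mul]; exact hτP
  have hντ : cK * ν * (t - s) = (cK * (M * W.period)) * sP := by rw [hsP, hPdef]; field_simp
  have hexp : Real.exp (-(cK * ν * (t - s))) ≤ (P / (t - s)) ^ e / (cK * (M * W.period)) := by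
    rw [hντ]
    have h := exp_neg_le_rpow_div (mul_pos hcK hMW) hsP1 he1
    have e1 : 1 / sP = P / (t - s) := by rw [hsP, one_div_div]
    rwa [e1] at h
  -- `dW ≥ ½ min 1 θL`
  have hq : L ^ 2 ≤ Torus.freqNormSq ℓ := by
    rw [← Torus.norm_latticeVec_sq]; exact pow_le_pow_left₀ hL.le hℓL 2
  have hRτ : θL ≤ 8 * Real.pi ^ 2 * loT lo Λ c ν n * Torus.freqNormSq ℓ * (t - s) := by
    refine hθL.trans ?_
    have h1 : 8 * Real.pi ^ 2 * loT lo Λ c ν n * L ^ 2 ≤ 8 * Real.pi ^ 2 * loT lo Λ c ν n * Torus.freqNormSq ℓ :=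
      mul_le_mul_of_nonneg_left hq (by positivity)
    exact mul_le_mul h1 hτP (by positivity) (by have := Torus.freqNormSq_nonneg ℓ; positivity)
  have hdW : (1 / 2) * min 1 θL ≤ dW lo Λ c ν n (t - s) ℓ := by
    have h := VmodGen.one_sub_exp_neg_ge (le_trans hθL0.le hRτ)
    have hm : min 1 θL ≤ min 1 (8 * Real.pi ^ 2 * loT lo Λ c ν n * Torus.freqNormSq ℓ * (t - s)) := min_le_min le_rfl hRτ
    unfold dW; linarith
  have hm0 : 0 < (1 / 2) * min 1 θL := by have : 0 < min 1 θL := lt_min one_pos hθL0; positivity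
  have hsq0 : 0 < Real.sqrt ((1 / 2) * min 1 θL) := Real.sqrt_pos.2 hm0
  -- assembling
  have hC₁0 : 0 ≤ C₁ := le_trans (by positivity) hC₁
  have hPe0 : 0 ≤ (P / (t - s)) ^ e := Real.rpow_nonneg (by positivity) e
  have hy1 : P / (t - s) ≤ 1 := (div_le_one hτ0).2 hτP
  have hmin : min 1 (M * W.period / ν / (t - s)) = P / (t - s) := by rw [← hPdef]; exact min_eq_right hy1
  have hνe0 : 0 ≤ ν ^ e := Real.rpow_nonneg hν0.le e
  have hue : 0 ≤ ((⌈K / ν⌉₊ : ℝ) / n) ^ e := Real.rpow_nonneg (by positivity) e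
  have halw : C₁ * (P / (t - s)) ^ e ≤ C₁ * (C₁ * (ν ^ e + ((⌈K / ν⌉₊ : ℝ) / n) ^ e) + (min 1 ((M * W.period / ν) / (t - s))) ^ e) := by
    rw [hmin]
    have : 0 ≤ C₁ * (ν ^ e + ((⌈K / ν⌉₊ : ℝ) / n) ^ e) := by positivity
    nlinarith
  have hv0 := norm_nonneg v
  -- `√CK e^{C₀} e^{−cKντ} ≤ C₁ (P/τ)^e √(½ min 1 θL)`
  have hkey : Real.sqrt CK * Real.exp (cK * (M * W.period)) * Real.exp (-(cK * ν * (t - s)))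
      ≤ C₁ * (P / (t - s)) ^ e * Real.sqrt ((1 / 2) * min 1 θL) := by
    have h1 : Real.sqrt CK * Real.exp (cK * (M * W.period)) * Real.exp (-(cK * ν * (t - s)))
        ≤ Real.sqrt CK * Real.exp (cK * (M * W.period)) * ((P / (t - s)) ^ e / (cK * (M * W.period))) :=
      mul_le_mul_of_nonneg_left hexp (by positivity)
    refine h1.trans ?_
    have h2 : Real.sqrt CK * Real.exp (cK * (M * W.period)) * ((P / (t - s)) ^ e / (cK * (M * W.period)))
        = (Real.sqrt CK * Real.exp (cK * (M * W.period)) / (cK * (M * W.period) * Real.sqrt ((1 / 2) * min 1 θL)))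
          * (P / (t - s)) ^ e * Real.sqrt ((1 / 2) * min 1 θL) := by
      field_simp
    rw [h2]
    exact mul_le_mul_of_nonneg_right (mul_le_mul_of_nonneg_right hC₁ hPe0) hsq0.le
  calc ‖fc (U s t v) ℓ‖ ≤ Real.sqrt CK * Real.exp (cK * (M * W.period)) * Real.exp (-(cK * ν * (t - s))) * ‖v‖ := hTH
    _ ≤ C₁ * (P / (t - s)) ^ e * Real.sqrt ((1 / 2) * min 1 θL) * ‖v‖ := mul_le_mul_of_nonneg_right hkey hv0
    _ ≤ (C₁ * (C₁ * (ν ^ e + ((⌈K / ν⌉₊ : ℝ) / n) ^ e) + (min 1 ((M * W.period / ν) / (t - s))) ^ e))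
        * Real.sqrt (dW lo Λ c ν n (t - s) ℓ) * ‖v‖ := by
        refine mul_le_mul_of_nonneg_right ?_ hv0
        exact mul_le_mul halw (Real.sqrt_le_sqrt hdW) hsq0.le (by positivity)

end Summit.AnomalousDissipation.AnomalousDissipation.Theorems.SolenoidalFractalHomogenisation.LagrangianStep.VmodFlat

end
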